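import Summits.RiemannHypothesis.RiemannHypothesis.Theorems.Splittings.LiLowZeroBudget
import HarnessLib

/-!
# Increment decomposition [α]: `Δ_n = highPart + lowSum` at height `Y` (li-bridge g6 SketchG6C §§1–3)

Cell rh-split, seat rh-split-li-bridge g6 (brief sha16 f79c5f09d8bcb036), card `run/shared/lean/pub/rh-split/cards/SPLIT-li-bridge.md` §13
(13.5 paper proof «SOUND ON PAPER», referee rh-split-ref g3 06:17:36Z; 13.17); kernel source `HOME/rh-split-li-bridge/SketchG6T.lean` sha16
911a043700f05677 (2287 l; = SketchG6B [γ] ++ SketchG6C [α][β] ++ Part D [δ] ++ Part T, re-pointed at the tree's `LiIncrMeanSquare` /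
`LiIncrBlockLaw`, p508264 / p508611).  Filed by rh-split-typer-2 g4 (lane (xi)(c)–(f)) as a chain of ten tree modules cut at the scratch's
section boundaries, decl text byte-verbatim; deltas = namespaces `RhSplit.LiBridgeG6B/C/D/T` ↦
`…Theorems.Splittings.{LiLowZeroBudget, LiIncrHighPart, LiIncrBlockLawOfRH}` (qualified cross-references rewritten), module docstrings, and
one-line docstrings added where the scratch had none.  END-TO-END statement of the chain (last file):
`LiIncrBlockLawOfRH.rh_iff_almostAllLiMonotone : RiemannHypothesis ↔ ∃ E ⊆ ℕ of natural density zero, ∀ n ≥ 1, n ∉ E → λ_n ≤ λ_{n+1}`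
— T-Li3 IN KERNEL, a RELABELLING of RH (RH-EQUIVALENT, PROVED; certifies nothing about RH; class (li, bridge) unchanged).

This file: §1 objects (`liIncr`, `mult`, `incrWeight`), §2 the Bombieri–Lagarias box sum and its limit, §3 splitting at height `Y` (stub [α]).

Gate dedup: `zerosBetween_split` are `private` here (they restate landed lemmas of other modules; private plumbing).

HONEST LABEL: «SPLITTING SEARCH over kernel-typed RH-EQUIVALENCES; a splitting A ∧ B ⟹ RH is CONDITIONAL bookkeeping unless A and B are
both proved; nothing here bears on the truth of RH.»
-/

set_option linter.dupNamespace false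

noncomputable section

namespace Summit.RiemannHypothesis.RiemannHypothesis.Theorems.Splittings.LiIncrHighPart

open Filter Topology Finset Set MeasureTheory
open scoped Real
open Literature.NumberTheory.LFunctions Literature.NumberTheory.LFunctions.SchoenfeldBound
open Literature.NumberTheory.DiophantineGeometry
open Summit.RiemannHypothesis.RiemannHypothesis.Theorems.LiTheory
open Summit.RiemannHypothesis.RiemannHypothesis.Theorems.LiTheory.SmoothReplace
open Summit.RiemannHypothesis.RiemannHypothesis.Theorems.LiTheory.Window

/-! ## §1 Objects -/

/-- `Δ_n := λ_{n+1} − λ_n` (same body as `RhSplit.LiBridgeG6.liIncr`). -/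
def liIncr (n : ℕ) : ℝ := keiperLiCoeff (n + 1) - keiperLiCoeff n

/-- Multiplicity as a real number. -/
def mult (ρ : ℂ) : ℝ := (riemannZetaZeroOrder ρ : ℝ)

/-- The increment weight `w_n := 2 (f_{n+1} − f_n)` (`f_n = liWindowWeight n = 1 − cos(nθ)`). -/
def incrWeight (n : ℕ) (t : ℝ) : ℝ := 2 * (liWindowWeight (n + 1) t - liWindowWeight n t)

/-- Its derivative (away from `t = 0`). -/
def incrWeightDeriv (n : ℕ) (t : ℝ) : ℝ :=
  2 * (liWindowWeightDeriv (n + 1) t - liWindowWeightDeriv n t)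

/-- `w_n(t) = 4 sin(θ_t/2) sin((n+½)θ_t)` — the typed amplitude/phase shape of card §13.5. -/
theorem incrWeight_eq (n : ℕ) (t : ℝ) :
    incrWeight n t =
      4 * Real.sin (liZeroAngle t / 2) * Real.sin (((n : ℝ) + 1 / 2) * liZeroAngle t) := by
  have h := Real.cos_sub_cos ((n : ℝ) * liZeroAngle t) (((n : ℝ) + 1) * liZeroAngle t)
  have e1 : ((n : ℝ) * liZeroAngle t + ((n : ℝ) + 1) * liZeroAngle t) / 2 =
      ((n : ℝ) + 1 / 2) * liZeroAngle t := by ring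
  have e2 : ((n : ℝ) * liZeroAngle t - ((n : ℝ) + 1) * liZeroAngle t) / 2 = -(liZeroAngle t / 2) := by
    ring
  rw [e1, e2, Real.sin_neg] at h
  unfold incrWeight liWindowWeight
  push_cast
  linear_combination 2 * h

/-- Auxiliary lemma `hasDerivAt_incrWeight` of the increment decomposition [α] (li-bridge g6 `SketchG6T`; see the module docstring for its place in the argument). -/
theorem hasDerivAt_incrWeight (n : ℕ) {t : ℝ} (ht : t ≠ 0) :
    HasDerivAt (incrWeight n) (incrWeightDeriv n t) t := by
  have h := ((hasDerivAt_liWindowWeight (n + 1) ht).sub (hasDerivAt_liWindowWeight n ht)).const_mul 2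
  exact h.congr_of_eventuallyEq (Eventually.of_forall fun x ↦ rfl)

/-- Auxiliary lemma `continuousOn_incrWeightDeriv` of the increment decomposition [α] (li-bridge g6 `SketchG6T`; see the module docstring for its place in the argument). -/
theorem continuousOn_incrWeightDeriv (n : ℕ) {a b : ℝ} (ha : 0 < a) :
    ContinuousOn (incrWeightDeriv n) (Set.Icc a b) :=
  continuousOn_const.mul
    ((continuousOn_liWindowWeightDeriv (n + 1) ha).sub (continuousOn_liWindowWeightDeriv n ha))

/-! ## §2 The Bombieri–Lagarias box sum and its limit -/

/-- `Λ_n(T) = Σ_{ρ ∈ liZeroBox T} m(ρ)(1 − (1 − 1/ρ)ⁿ)` as a `Finset` sum (as in SketchG6 §0). -/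
def boxSum (n : ℕ) (T : ℝ) : ℂ :=
  ∑ ρ ∈ (liZeroBox_finite T).toFinset, (riemannZetaZeroOrder ρ : ℂ) * (1 - (1 - 1 / ρ) ^ n)

/-- Auxiliary lemma `boxSum_eq_finsum` of the increment decomposition [α] (li-bridge g6 `SketchG6T`; see the module docstring for its place in the argument). -/
theorem boxSum_eq_finsum (n : ℕ) (T : ℝ) :
    boxSum n T = ∑ᶠ ρ ∈ liZeroBox T, (riemannZetaZeroOrder ρ : ℂ) * (1 - (1 - 1 / ρ) ^ n) := by
  rw [boxSum, finsum_mem_eq_finite_toFinset_sum _ (liZeroBox_finite T)]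

/-- Auxiliary lemma `tendsto_boxSum` of the increment decomposition [α] (li-bridge g6 `SketchG6T`; see the module docstring for its place in the argument). -/
theorem tendsto_boxSum {n : ℕ} (hn : 1 ≤ n) :
    Tendsto (fun T : ℝ ↦ boxSum n T) atTop (𝓝 (keiperLiCoeff n : ℂ)) := by
  have h : (fun T : ℝ ↦ boxSum n T)
      = fun T : ℝ ↦ ∑ᶠ ρ ∈ liZeroBox T, (riemannZetaZeroOrder ρ : ℂ) * (1 - (1 - 1 / ρ) ^ n) :=
    funext (boxSum_eq_finsum n)
  rw [h]
  exact keiperLiCoeff_eq_zero_sum_holds n hn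

/-- Auxiliary lemma `zerosBetween_self` of the increment decomposition [α] (li-bridge g6 `SketchG6T`; see the module docstring for its place in the argument). -/
theorem zerosBetween_self (T : ℝ) (hT : 0 ≤ T) : zerosBetween T T = ∅ := by
  ext ρ
  simp only [Finset.notMem_empty, iff_false]
  intro h
  obtain ⟨-, -, -, h3, h4⟩ := (mem_zerosBetween hT).1 h
  exact absurd h4 (not_le.2 h3)

/-- **Under RH the two-sided box comparison is exact:** `Re Λ_n(T') = 2 Σ_{0<γ≤T'} m f_n(γ)`
for `T' ≥ 4`, `n ≤ T'²/4` (`liBoxTwoSided_bound` with `T = T'`: the error sums are empty). -/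
theorem re_boxSum_eq_of_rh (hRH : RiemannHypothesis) {n : ℕ} {T' : ℝ} (h4 : 4 ≤ T')
    (hn : (n : ℝ) ≤ T' ^ 2 / 4) :
    (boxSum n T').re = 2 * ∑ ρ ∈ zerosBetween 0 T', mult ρ * liWindowWeight n ρ.im := by
  have h := liBoxTwoSided_bound n T' T' (RiemannHypothesisUpTo.of_riemannHypothesis hRH T') h4 le_rfl hn
  rw [← boxSum_eq_finsum, zerosBetween_self T' (by linarith)] at h
  simp only [Finset.sum_empty, mul_zero, add_zero] at h
  have h0 := abs_nonpos_iff.1 h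
  unfold mult
  linarith

/-- `λ_n = lim_{T'} 2 Σ_{0<γ≤T'} m f_n(γ)` under RH (`n ≥ 1`). -/
theorem tendsto_window_sum (hRH : RiemannHypothesis) {n : ℕ} (hn : 1 ≤ n) :
    Tendsto (fun T' : ℝ ↦ 2 * ∑ ρ ∈ zerosBetween 0 T', mult ρ * liWindowWeight n ρ.im) atTop
      (𝓝 (keiperLiCoeff n)) := by
  have h1 : Tendsto (fun T' : ℝ ↦ (boxSum n T').re) atTop (𝓝 ((keiperLiCoeff n : ℂ).re)) :=
    (Complex.continuous_re.tendsto _).comp (tendsto_boxSum hn)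
  rw [Complex.ofReal_re] at h1
  refine h1.congr' ?_
  filter_upwards [eventually_ge_atTop (max 4 (2 * Real.sqrt n))] with T' hT'
  have h4 : 4 ≤ T' := (le_max_left _ _).trans hT'
  have hs : 2 * Real.sqrt n ≤ T' := (le_max_right _ _).trans hT'
  have hn' : (n : ℝ) ≤ T' ^ 2 / 4 := by
    have h0 : 0 ≤ Real.sqrt n := Real.sqrt_nonneg _
    have hsq : Real.sqrt n ^ 2 = n := Real.sq_sqrt (Nat.cast_nonneg n)
    nlinarith
  exact re_boxSum_eq_of_rh hRH h4 hn'

/-- **`Δ_n = lim_{T'} Σ_{0<γ≤T'} m w_n(γ)` under RH** (`n ≥ 1`). -/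
theorem tendsto_incr_sum (hRH : RiemannHypothesis) {n : ℕ} (hn : 1 ≤ n) :
    Tendsto (fun T' : ℝ ↦ ∑ ρ ∈ zerosBetween 0 T', mult ρ * incrWeight n ρ.im) atTop
      (𝓝 (liIncr n)) := by
  have h := (tendsto_window_sum hRH (n := n + 1) (by omega)).sub (tendsto_window_sum hRH hn)
  unfold liIncr
  refine Tendsto.congr (fun T' ↦ ?_) h
  rw [Finset.mul_sum, Finset.mul_sum, ← Finset.sum_sub_distrib]
  apply Finset.sum_congr rfl
  intro ρ _
  unfold incrWeight
  ring

/-! ## §3 Splitting at height `Y`: stub [α] -/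

/-- Auxiliary lemma `zerosBetween_split` of the increment decomposition [α] (li-bridge g6 `SketchG6T`; see the module docstring for its place in the argument). -/
private theorem zerosBetween_split {a b c : ℝ} (ha : 0 ≤ a) (hab : a ≤ b) (hbc : b ≤ c) :
    zerosBetween a c = zerosBetween a b ∪ zerosBetween b c ∧
      Disjoint (zerosBetween a b) (zerosBetween b c) := by
  have hb : 0 ≤ b := ha.trans hab
  constructor
  · ext ρ
    rw [Finset.mem_union, mem_zerosBetween ha, mem_zerosBetween ha, mem_zerosBetween hb]
    constructor
    · rintro ⟨hz, h1, h2, h3, h4⟩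
      rcases le_or_gt ρ.im b with h | h
      · exact Or.inl ⟨hz, h1, h2, h3, h⟩
      · exact Or.inr ⟨hz, h1, h2, h, h4⟩
    · rintro (⟨hz, h1, h2, h3, h4⟩ | ⟨hz, h1, h2, h3, h4⟩)
      · exact ⟨hz, h1, h2, h3, h4.trans hbc⟩
      · exact ⟨hz, h1, h2, hab.trans_lt h3, h4⟩
  · rw [Finset.disjoint_left]
    intro ρ hρ hρ'
    obtain ⟨-, -, -, -, h4⟩ := (mem_zerosBetween ha).1 hρ
    obtain ⟨-, -, -, h3, -⟩ := (mem_zerosBetween hb).1 hρ'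
    exact absurd h4 (not_le.2 h3)

/-- The low-zero trigonometric sum `Σ_{0<γ≤Y} a_γ sin((n+½)θ_γ)`, `a_γ = 4 m sin(θ_γ/2)`. -/
def lowSum (n : ℕ) (Y : ℝ) : ℝ :=
  ∑ ρ ∈ zerosBetween 0 Y,
    mult ρ * (4 * Real.sin (liZeroAngle ρ.im / 2)) * Real.sin (((n : ℝ) + 1 / 2) * liZeroAngle ρ.im)

/-- The high-zero part `P_Y(n) := Δ_n − lowSum` (a limit of finite high sums, next theorem). -/
def highPart (n : ℕ) (Y : ℝ) : ℝ := liIncr n - lowSum n Y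

/-- Auxiliary lemma `liIncr_eq_highPart_add_lowSum` of the increment decomposition [α] (li-bridge g6 `SketchG6T`; see the module docstring for its place in the argument). -/
theorem liIncr_eq_highPart_add_lowSum (n : ℕ) (Y : ℝ) :
    liIncr n = highPart n Y + lowSum n Y := by
  unfold highPart; ring

/-- **Stub [α] (RH ⟹ exact decomposition).**  For `n ≥ 1`, `Y ≥ 0`:
`Σ_{Y<γ≤T'} m w_n(γ) ⟶ P_Y(n) = Δ_n − Σ_{0<γ≤Y} 4 m sin(θ_γ/2) sin((n+½)θ_γ)` as `T' → ∞`. -/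
theorem incr_decomposition (hRH : RiemannHypothesis) {n : ℕ} (hn : 1 ≤ n) {Y : ℝ} (hY : 0 ≤ Y) :
    Tendsto (fun T' : ℝ ↦ ∑ ρ ∈ zerosBetween Y T', mult ρ * incrWeight n ρ.im) atTop
      (𝓝 (highPart n Y)) := by
  have h := (tendsto_incr_sum hRH hn).sub_const (lowSum n Y)
  unfold highPart
  refine h.congr' ?_
  filter_upwards [eventually_ge_atTop Y] with T' hT'
  obtain ⟨hU, hD⟩ := zerosBetween_split le_rfl hY hT'
  rw [hU, Finset.sum_union hD]
  have hlow : ∑ ρ ∈ zerosBetween 0 Y, mult ρ * incrWeight n ρ.im = lowSum n Y := by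
    unfold lowSum
    apply Finset.sum_congr rfl
    intro ρ _
    rw [incrWeight_eq]
    ring
  rw [hlow]
  ring

/-- The same with the summit's `Summit.RiemannHypothesis` spelling. -/
theorem incr_decomposition' (hRH : Summit.RiemannHypothesis) {n : ℕ} (hn : 1 ≤ n) {Y : ℝ}
    (hY : 0 ≤ Y) :
    Tendsto (fun T' : ℝ ↦ ∑ ρ ∈ zerosBetween Y T', mult ρ * incrWeight n ρ.im) atTop
      (𝓝 (highPart n Y)) :=
  incr_decomposition hRH hn hY

end Summit.RiemannHypothesis.RiemannHypothesis.Theorems.Splittings.LiIncrHighPart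

end
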